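/-
Copyright (c) 2026 the pub-hodgecm-mathlib formalisation cell (harness21).  Prover seat hodgecm-mathlib-K2Liu-p08 (g4), Track B «K2-LIT» ∕ hLiu418
#184♮, socket #42S organ S1 (ROAD W), brick F8 (K-tot)-split′ (LEAD BATCH #23 «p08 split twin»): the split total coordinate is a HOMEOMORPHISM.
2026-09-04.  KERNEL: theorems only.
-/
import Summits.HodgeConjecture.HodgeConjecture.Theorems.K2LiuSplitWitnessCoordinate   -- ★ p860876 (K-tot)-split `exists_split_witness_coordinate`
import HarnessLib

/-!
# Crux `HLiu418`, #42S-S1 ROAD W, brick (K-tot)-split′: THE SPLIT WITNESS COORDINATE `κ′ = θ ∘ κ : X ≃ (Fin 2 → E_{w₀})⁶` IS BICONTINUOUS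

Cell `hodgecm-mathlib`, crux item hLiu418 = `stmt-HodgeConjecture-24832` (helper lane `--supports … --as helper`, count-neutral).  THEOREMS ONLY (no `def`, no instance,
no notation, no named-fact hypothesis, no `sorry`).  ★ (K-tot)-split gives `κ` (a homeomorphism) and the regrouping `θ` (continuous, explicit).  Here: `θ⁻¹` is continuous too —
it is the EXPLICIT lift `(a, b) ↦ 1_{w₀}·a + σ(1_{w₀}·b)` of the `w₀`-reading (`Pi.single` and `σ` are continuous) — so `κ′ := κ.trans θ` is a bicontinuous additive
equivalence `X ≃+ (Fin 2 → E_{w₀})⁶` carrying the frame-Gram readings `hK2`: exactly the `κ` of ★ (W1-d) `witness_mem_schwartzBruhat` ∕ ★ (W2-g) `integrable_indicator_sub_indicator`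
(which need BOTH directions continuous) and of ★ (W2-d∕f)-split `sum_two_depths_ne_zero_split_witness`.
* `continuous_symm_of_regroup` (the lift reads as `(a, b)`), ★★ **`exists_split_witness_homeomorph`**.
[Shimura1997, §13.2] [CasselsFrohlichANT1967, Ch. II §10, Ch. VII §1.1].
HONEST LABEL.  Count-neutral helper; `HC_CM` is proved only modulo the 7 printed citations (2 remaining named inputs: hLiu418 = `stmt-HodgeConjecture-24832`,
h413 = `stmt-HodgeConjecture-24833`) until rung 0 closes.

## References
* [Shimura1997] G. Shimura, CBMS 93 (1997), §13.2.   * [CasselsFrohlichANT1967] Cassels–Fröhlich (1967), Ch. II §10, Ch. VII §1.1.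
-/

set_option autoImplicit false
set_option linter.dupNamespace false -- the mandated namespace repeats `HodgeConjecture.HodgeConjecture`

open Matrix
open Literature.NumberTheory.Automorphic Literature.NumberTheory.Automorphic.UnitaryGroup

namespace Summit.HodgeConjecture.HodgeConjecture.Cruxes.HLiu418.K2LiuSplitWitnessCoordinateHomeomorph

open K2LiuSplitWitnessCoordinate K2LiuLocalRingSplitReading

variable {F E : Type} [Field F] [NumberField F] [Field E] [NumberField E] [Algebra F E] [Algebra.IsQuadraticExtension F E]
  (c : E ≃ₐ[F] E) {δ : E} (hcδ : c δ = -δ) (hδ : δ ≠ 0) (v : IsDedekindDomain.HeightOneSpectrum (NumberField.RingOfIntegers F))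
  (w₀ : PlacesOver E v) (hw₀ : c • w₀.1 ≠ w₀.1)

/-! ## §1 `θ⁻¹` is continuous -/

include hcδ hδ hw₀ in
/-- **THE REGROUPING IS BICONTINUOUS**: an additive equivalence `θ` with the reading formula of ★ `exists_split_regroup` has a continuous inverse — the inverse is the explicit
lift of §1 in each of the six blocks. [cite: Shimura1997, §13.2] -/
theorem continuous_symm_of_regroup (θ : ((Fin 2 → LocalRing E v) × (Fin 2 → LocalRing E v) × (Fin 2 → LocalRing E v)) ≃+ ((Fin 2 → (w₀.1).adicCompletion E) × (Fin 2 → (w₀.1).adicCompletion E) × (Fin 2 → (w₀.1).adicCompletion E) × (Fin 2 → (w₀.1).adicCompletion E) × (Fin 2 → (w₀.1).adicCompletion E) × (Fin 2 → (w₀.1).adicCompletion E)))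
    (hθ : ∀ t, θ t = (fun j => conjLocal E c v (t.2.1 j) w₀, fun j => t.2.1 j w₀, fun j => t.1 j w₀, fun j => conjLocal E c v (t.1 j) w₀,
          fun j => t.2.2 j w₀, fun j => conjLocal E c v (t.2.2 j) w₀)) :
    Continuous θ.symm := by
  classical
  have hne : PlacesOver.galInv c w₀ ≠ w₀ := PlacesOver.galInv_ne c w₀ hw₀
  -- the lift `1_{w₀}a + σ(1_{w₀}b)` reads as `(a, b)`
  have hL1 : ∀ a b : (w₀.1).adicCompletion E, (Pi.single (M := fun w : PlacesOver E v => w.1.adicCompletion E) w₀ a + conjLocal E c v (Pi.single (M := fun w : PlacesOver E v => w.1.adicCompletion E) w₀ b)) w₀ = a := fun a b => by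
    have h0 : (Pi.single (M := fun w : PlacesOver E v => w.1.adicCompletion E) w₀ b) ⟨c⁻¹ • w₀.1, under_inv_smul_eq c w₀⟩ = 0 :=
      Pi.single_eq_of_ne (M := fun w : PlacesOver E v => w.1.adicCompletion E) hne b
    rw [Pi.add_apply, conjLocal_apply, h0, map_zero, add_zero, Pi.single_eq_same]
  have hL2 : ∀ a b : (w₀.1).adicCompletion E, conjLocal E c v (Pi.single (M := fun w : PlacesOver E v => w.1.adicCompletion E) w₀ a + conjLocal E c v (Pi.single (M := fun w : PlacesOver E v => w.1.adicCompletion E) w₀ b)) w₀ = b := fun a b => by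
    have h0 : (Pi.single (M := fun w : PlacesOver E v => w.1.adicCompletion E) w₀ a) ⟨c⁻¹ • w₀.1, under_inv_smul_eq c w₀⟩ = 0 :=
      Pi.single_eq_of_ne (M := fun w : PlacesOver E v => w.1.adicCompletion E) hne a
    rw [map_add, conjLocal_conjLocal c v hcδ hδ, Pi.add_apply, conjLocal_apply, h0, map_zero, zero_add, Pi.single_eq_same]
  -- the explicit inverse
  have hG : ∀ y : (Fin 2 → (w₀.1).adicCompletion E) × (Fin 2 → (w₀.1).adicCompletion E) × (Fin 2 → (w₀.1).adicCompletion E) × (Fin 2 → (w₀.1).adicCompletion E) × (Fin 2 → (w₀.1).adicCompletion E) × (Fin 2 → (w₀.1).adicCompletion E), θ.symm y =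
      (fun j => Pi.single (M := fun w : PlacesOver E v => w.1.adicCompletion E) w₀ (y.2.2.1 j) + conjLocal E c v (Pi.single (M := fun w : PlacesOver E v => w.1.adicCompletion E) w₀ (y.2.2.2.1 j)),
       fun j => Pi.single (M := fun w : PlacesOver E v => w.1.adicCompletion E) w₀ (y.2.1 j) + conjLocal E c v (Pi.single (M := fun w : PlacesOver E v => w.1.adicCompletion E) w₀ (y.1 j)),
       fun j => Pi.single (M := fun w : PlacesOver E v => w.1.adicCompletion E) w₀ (y.2.2.2.2.1 j) + conjLocal E c v (Pi.single (M := fun w : PlacesOver E v => w.1.adicCompletion E) w₀ (y.2.2.2.2.2 j))) := by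
    intro y
    apply θ.injective
    rw [AddEquiv.apply_symm_apply, hθ]
    simp only [hL1, hL2]
  have hfun : (θ.symm : ((Fin 2 → (w₀.1).adicCompletion E) × (Fin 2 → (w₀.1).adicCompletion E) × (Fin 2 → (w₀.1).adicCompletion E) × (Fin 2 → (w₀.1).adicCompletion E) × (Fin 2 → (w₀.1).adicCompletion E) × (Fin 2 → (w₀.1).adicCompletion E)) → ((Fin 2 → LocalRing E v) × (Fin 2 → LocalRing E v) × (Fin 2 → LocalRing E v))) = fun y =>
      (fun j => Pi.single (M := fun w : PlacesOver E v => w.1.adicCompletion E) w₀ (y.2.2.1 j) + conjLocal E c v (Pi.single (M := fun w : PlacesOver E v => w.1.adicCompletion E) w₀ (y.2.2.2.1 j)),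
       fun j => Pi.single (M := fun w : PlacesOver E v => w.1.adicCompletion E) w₀ (y.2.1 j) + conjLocal E c v (Pi.single (M := fun w : PlacesOver E v => w.1.adicCompletion E) w₀ (y.1 j)),
       fun j => Pi.single (M := fun w : PlacesOver E v => w.1.adicCompletion E) w₀ (y.2.2.2.2.1 j) + conjLocal E c v (Pi.single (M := fun w : PlacesOver E v => w.1.adicCompletion E) w₀ (y.2.2.2.2.2 j))) := funext hG
  rw [hfun]
  have hσ := continuous_conjLocal E c v
  have hs : Continuous fun a : (w₀.1).adicCompletion E => (Pi.single (M := fun w : PlacesOver E v => w.1.adicCompletion E) w₀ a : LocalRing E v) :=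
    continuous_single (A := fun w : PlacesOver E v => w.1.adicCompletion E) w₀
  have hL : ∀ (p q : ((Fin 2 → (w₀.1).adicCompletion E) × (Fin 2 → (w₀.1).adicCompletion E) × (Fin 2 → (w₀.1).adicCompletion E) × (Fin 2 → (w₀.1).adicCompletion E) × (Fin 2 → (w₀.1).adicCompletion E) × (Fin 2 → (w₀.1).adicCompletion E)) → (Fin 2 → (w₀.1).adicCompletion E)), Continuous p → Continuous q →
      Continuous fun y : (Fin 2 → (w₀.1).adicCompletion E) × (Fin 2 → (w₀.1).adicCompletion E) × (Fin 2 → (w₀.1).adicCompletion E) × (Fin 2 → (w₀.1).adicCompletion E) × (Fin 2 → (w₀.1).adicCompletion E) × (Fin 2 → (w₀.1).adicCompletion E) => fun j : Fin 2 => (Pi.single (M := fun w : PlacesOver E v => w.1.adicCompletion E) w₀ (p y j) + conjLocal E c v (Pi.single (M := fun w : PlacesOver E v => w.1.adicCompletion E) w₀ (q y j)) : LocalRing E v) :=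
    fun p q hp hq => continuous_pi fun j => (hs.comp ((continuous_apply j).comp hp)).add (hσ.comp (hs.comp ((continuous_apply j).comp hq)))
  exact (hL _ _ (continuous_fst.comp (continuous_snd.comp continuous_snd)) (continuous_fst.comp (continuous_snd.comp (continuous_snd.comp continuous_snd)))).prodMk
    ((hL _ _ (continuous_fst.comp continuous_snd) continuous_fst).prodMk
    (hL _ _ (continuous_fst.comp (continuous_snd.comp (continuous_snd.comp (continuous_snd.comp continuous_snd))))
      (continuous_snd.comp (continuous_snd.comp (continuous_snd.comp (continuous_snd.comp continuous_snd))))))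

/-! ## §2 The bicontinuous split witness coordinate -/

include hcδ hδ hw₀ in
/-- **THE SPLIT WITNESS COORDINATE IS A HOMEOMORPHISM** `κ′ : Y ≃+ (Fin 2 → E_{w₀})⁶` reading the frame Gram (`hK2`, `d_K = 1`).
[cite: Shimura1997, §13.2] [cite: CasselsFrohlichANT1967, Ch. II §10] -/
theorem exists_split_witness_homeomorph {Y : Type*} [AddCommGroup Y] [TopologicalSpace Y] {ι' : Type*} (κ₀ : Y ≃+ (ι' → LocalRing E v))
    (hκ₀ : Continuous κ₀) (hκ₀' : Continuous κ₀.symm) (e : Fin 2 × Fin 3 ≃ ι')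
    {D : Matrix (Fin 3) (Fin 3) (LocalRing E v)} (hD : D.map (conjLocal E c v) = D) (hDt : Dᵀ = D) (hDu : IsUnit D.det) :
    ∃ κ' : Y ≃+ (Fin 2 → (w₀.1).adicCompletion E) × (Fin 2 → (w₀.1).adicCompletion E) × (Fin 2 → (w₀.1).adicCompletion E) × (Fin 2 → (w₀.1).adicCompletion E) × (Fin 2 → (w₀.1).adicCompletion E) × (Fin 2 → (w₀.1).adicCompletion E),
      Continuous κ' ∧ Continuous κ'.symm ∧
      (∀ x j i, (∑ k, ∑ l, κ₀ x (e (j, l)) * D k l * conjLocal E c v (κ₀ x (e (i, k)))) w₀ = (vecMulVec (κ' x).2.2.1 (κ' x).1 + vecMulVec (κ' x).2.1 (κ' x).2.2.2.1 + (1 : (w₀.1).adicCompletion E) • vecMulVec (κ' x).2.2.2.2.1 (κ' x).2.2.2.2.2) j i ∧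
        conjLocal E c v (∑ k, ∑ l, κ₀ x (e (j, l)) * D k l * conjLocal E c v (κ₀ x (e (i, k)))) w₀ = (vecMulVec (κ' x).2.2.1 (κ' x).1 + vecMulVec (κ' x).2.1 (κ' x).2.2.2.1 + (1 : (w₀.1).adicCompletion E) • vecMulVec (κ' x).2.2.2.2.1 (κ' x).2.2.2.2.2) i j) := by
  obtain ⟨κ, θ, hc, hc', hθc, hθ, -, hK2⟩ := exists_split_witness_coordinate c hcδ hδ v w₀ hw₀ κ₀ hκ₀ hκ₀' e hD hDt hDu
  exact ⟨κ.trans θ, hθc.comp hc, hc'.comp (continuous_symm_of_regroup c hcδ hδ v w₀ hw₀ θ hθ), fun x j i => hK2 x j i⟩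

end Summit.HodgeConjecture.HodgeConjecture.Cruxes.HLiu418.K2LiuSplitWitnessCoordinateHomeomorph
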